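import Mathlib.Geometry.Manifold.Instances.Sphere
import Mathlib.Geometry.Manifold.Diffeomorph
import Mathlib.AlgebraicTopology.FundamentalGroupoid.SimplyConnected
import Literature.Topology.FourManifolds.Cobordism
import Literature.Topology.FourManifolds.ConnectedSum
import Literature.Topology.FourManifolds.HomotopySpheres
import Literature.Topology.FourManifolds.ThetaFour
import Literature.Topology.FourManifolds.SmoothIntersectionForms
import HarnessLib

/-!
# Wall's stabilisation theorem: h-cobordant simply connected 4-manifolds are stably diffeomorphic

Topic `Literature/Topology/FourManifolds`; cite item wi-03819 (route SmoothPoincare4/Stabilisation,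
`Summits/SmoothPoincare4/Theorems/Stabilisation/Assembly.lean`).

**Wall 1964, Thm. 3.** If `M`, `N` are closed smooth simply connected 4-manifolds which are
h-cobordant, then `M # k (S² × S²)` and `N # k (S² × S²)` are diffeomorphic for some `k ≥ 0`.
Combined with `Θ₄ = 0` in Kervaire–Milnor's h-cobordism sense (every homotopy 4-sphere is
h-cobordant to `S⁴`; the tree's named fact `Literature.Topology.FourManifolds.isHCobordant_sphere_of_homotopySphere_four`,
`ThetaFour.lean`): every homotopy 4-sphere `Σ` satisfies `Σ # k (S² × S²) ≅ # k (S² × S²)` for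
some `k` (proved here from the two facts, `exists_isStabilization_sphere_of_homotopySphere_four`).

## Contents

* New API for the tree's relational, recursive predicate `Literature.SPC4.IsStabilization k M P`
  ("`P` is a `k`-fold stabilisation `M # k (S² × S²)`", `SmoothIntersectionForms.lean`: for
  `k = 0`, `P` is diffeomorphic to `M`; for `k + 1`, `P` is a connected sum `M' # (S² × S²)`,
  `Literature.Topology.FourManifolds.IsConnectedSum`, of some `k`-fold stabilisation `M'`): `IsStabilization.symm_zero`,
  `IsStabilization.succ`, `isStabilization_one_iff`, `isStabilization_one_of_isConnectedSum`,
  `IsStabilization.nonempty`, `nonempty_diffeomorph_of_isStabilization_zero`.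
* NAMED FACT `Literature.Topology.FourManifolds.exists_isStabilization_of_isHCobordant` (Wall 1964, Thm 3).
* Proved corollaries `Literature.Topology.FourManifolds.exists_isStabilization_sphere_of_homotopySphere_four` (every homotopy
  4-sphere is stably standard, from Wall Thm 3 + `Θ₄ = 0` + `π₁(S⁴) = 1`) and
  `Literature.Topology.FourManifolds.HomotopySphere.exists_isStabilization` (any two homotopy 4-spheres are stably
  diffeomorphic, given moreover transitivity of h-cobordism).

## Design and faithfulness

* The stabilisation predicate is the tree's `Literature.Topology.FourManifolds.IsStabilization`
  (`SmoothIntersectionForms.lean`, which states Wall's Thms 2+3 *combined*, from an isometry of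
  intersection forms, as `SPC4.isHCobordant_and_exists_isStabilization`); the present fact is
  Thm 3 alone, from an h-cobordism, which is what route SmoothPoincare4/Stabilisation consumes
  together with `Θ₄ = 0`. No second predicate is introduced.
* Orientations. Wall works with oriented manifolds and oriented h-cobordisms; the tree's
  `Literature.Topology.FourManifolds.IsHCobordant` (`Cobordism.lean`) and `Literature.Topology.FourManifolds.IsConnectedSum` are unoriented. This loses
  nothing here: an h-cobordism `W` between simply connected closed 4-manifolds is simply connected
  (its ends include as homotopy equivalences), hence orientable, so orienting `W` puts us in
  Wall's setting; and for connected `M` the diffeomorphism type of `M # (S² × S²)` is independent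
  of the discs and of orientations, because `S² × S²` admits an orientation-reversing
  diffeomorphism (Kervaire–Milnor 1963, §2; Wall 1964, §1). So "some `P` is a `k`-fold
  stabilisation of both `M` and `N`" is equivalent to the printed
  "`M # k (S² × S²) ≅ N # k (S² × S²)`".
* All manifolds live in `Type`, as forced by `Literature.Topology.FourManifolds.IsHCobordant` (common universe of `M`, `N`,
  `W`) and by `Literature.Topology.FourManifolds.HomotopySphere` (carrier in `Type`).
* Simple connectivity of `S⁴` is Mathlib-absent (no `SimplyConnectedSpace (Metric.sphere …)`
  instance); it is the tree's named fact `Literature.Topology.FourManifolds.simplyConnectedSpace_sphere_four`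
  (`HomotopyS4SimplyConnected.lean`, which imports all of `Mathlib`), taken here as the explicit
  hypothesis `hS4 : SimplyConnectedSpace (𝕊 4)` (definitionally that fact) to keep imports light.

## References

* C. T. C. Wall, *On simply-connected 4-manifolds*, J. London Math. Soc. 39 (1964) 141–149,
  §1 and Thm. 3 (also Thm. 2: isomorphic forms ⇒ h-cobordant). [Wall1964]
* M. Kervaire, J. Milnor, *Groups of homotopy spheres I*, Ann. of Math. 77 (1963) 504–537,
  Thm. 1.1 (`Θ₄ = 0`) and §2 (connected sum). [KervaireMilnorAnnals1963]
* R. Gompf, A. Stipsicz, *4-Manifolds and Kirby Calculus* (1999), §9.1 (Thm. 9.1.11 ff.).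
-/

noncomputable section

open scoped Manifold ContDiff
open ContinuousMap

namespace Literature.Topology.FourManifolds

/-- Local notation: `𝔼 n` is the model Euclidean space `EuclideanSpace ℝ (Fin n)`. -/
local notation "𝔼 " n:arg => EuclideanSpace ℝ (Fin n)

/-- Local notation: `𝕊 n` is the unit sphere in `EuclideanSpace ℝ (Fin (n + 1))`, the standard
`n`-sphere with its Mathlib manifold structure. -/
local notation "𝕊 " n:arg => (Metric.sphere (0 : EuclideanSpace ℝ (Fin (n + 1))) 1)

/-! ### More API for `SPC4.IsStabilization` -/

section SPC4

/-- `0`-fold stabilisation is symmetric (invert the diffeomorphism). [folklore] -/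
theorem IsStabilization.symm_zero {M : Type} [TopologicalSpace M] [ChartedSpace (𝔼 4) M]
    {P : Type} [TopologicalSpace P] [ChartedSpace (𝔼 4) P] (h : IsStabilization 0 M P) :
    IsStabilization 0 P M :=
  h.map Diffeomorph.symm

/-- Two manifolds with a common `0`-fold stabilisation are diffeomorphic (unfolding of
`IsStabilization 0`); in particular a homotopy 4-sphere that is stably standard with `k = 0`
summands is diffeomorphic to `S⁴`. [folklore] -/
theorem nonempty_diffeomorph_of_isStabilization_zero {M N : Type} [TopologicalSpace M]
    [ChartedSpace (𝔼 4) M] [TopologicalSpace N] [ChartedSpace (𝔼 4) N]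
    {P : Type} [TopologicalSpace P] [ChartedSpace (𝔼 4) P]
    (hM : IsStabilization 0 M P) (hN : IsStabilization 0 N P) :
    Nonempty (M ≃ₘ⟮𝓡 4, 𝓡 4⟯ N) := by
  obtain ⟨φ⟩ := hM
  obtain ⟨ψ⟩ := hN
  exact ⟨φ.trans ψ.symm⟩

/-- Constructor form of `isStabilization_succ_iff`: if `P` is a `k`-fold stabilisation of `M`
and `P'` is a connected sum `P # (S² × S²)`, then `P'` is a `(k+1)`-fold stabilisation of `M`
(Wall 1964, §1). [cite: Wall1964, §1] -/
theorem IsStabilization.succ {k : ℕ} {M : Type} [TopologicalSpace M] [ChartedSpace (𝔼 4) M]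
    {P : Type} [TopologicalSpace P] [T2Space P] [ChartedSpace (𝔼 4) P] [IsManifold (𝓡 4) ∞ P]
    {P' : Type} [TopologicalSpace P'] [ChartedSpace (𝔼 4) P']
    (h : IsStabilization k M P)
    (h' : IsConnectedSum (𝓡 4) (𝓡 4) ((𝓡 2).prod (𝓡 2)) P ((𝕊 2) × (𝕊 2)) P') :
    IsStabilization (k + 1) M P' :=
  ⟨P, _, _, _, ‹_›, h, h'⟩

/-- A `1`-fold stabilisation of `M` is a connected sum `M' # (S² × S²)` with `M'` diffeomorphic to
`M` (unfolding; Wall 1964, §1). [cite: Wall1964, §1] -/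
theorem isStabilization_one_iff (M : Type) [TopologicalSpace M] [ChartedSpace (𝔼 4) M]
    (P : Type) [TopologicalSpace P] [ChartedSpace (𝔼 4) P] :
    IsStabilization 1 M P ↔
      ∃ (M' : Type) (_ : TopologicalSpace M') (_ : T2Space M') (_ : ChartedSpace (𝔼 4) M')
        (_ : IsManifold (𝓡 4) ∞ M'),
        Nonempty (M ≃ₘ⟮𝓡 4, 𝓡 4⟯ M') ∧
          IsConnectedSum (𝓡 4) (𝓡 4) ((𝓡 2).prod (𝓡 2)) M' ((𝕊 2) × (𝕊 2)) P :=
  Iff.rfl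

/-- In particular any connected sum `M # (S² × S²)` is a `1`-fold stabilisation of `M`
(Wall 1964, §1). This is the shape of hypothesis S1 of the route's `stab_assembly`
("one stabilisation suffices"). [cite: Wall1964, §1] -/
theorem isStabilization_one_of_isConnectedSum {M : Type} [TopologicalSpace M] [T2Space M]
    [ChartedSpace (𝔼 4) M] [IsManifold (𝓡 4) ∞ M] {P : Type} [TopologicalSpace P]
    [ChartedSpace (𝔼 4) P]
    (h : IsConnectedSum (𝓡 4) (𝓡 4) ((𝓡 2).prod (𝓡 2)) M ((𝕊 2) × (𝕊 2)) P) :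
    IsStabilization 1 M P :=
  (isStabilization_zero_self M).succ h

/-- A stabilisation of a nonempty manifold is nonempty (for `k = 0` transport a point along the
diffeomorphism; for `k + 1` a connected sum along `4`-dimensional discs is nonempty,
`Literature.Topology.FourManifolds.IsConnectedSum.nonempty`). [folklore] -/
theorem IsStabilization.nonempty : ∀ {k : ℕ} {M : Type} [TopologicalSpace M]
    [ChartedSpace (𝔼 4) M] {P : Type} [TopologicalSpace P] [ChartedSpace (𝔼 4) P]
    [Nonempty M], IsStabilization k M P → Nonempty P
  | 0, _, _, _, _, _, _, _, ⟨φ⟩ => Nonempty.map φ ‹_›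
  | _ + 1, _, _, _, _, _, _, _, ⟨_, _, _, _, _, _, hcs⟩ => hcs.nonempty

end SPC4


/-! ### Wall's Theorem 3 -/

/-- NAMED FACT (**Wall 1964, Thm. 3**; Wall, *On simply-connected 4-manifolds*, J. London Math.
Soc. 39 (1964), Thm 3; Gompf–Stipsicz 1999, §9.1). If two closed smooth simply connected
4-manifolds `M`, `N` (Hausdorff, second countable, compact, `C^∞` on `ℝ⁴`) are h-cobordant
(`Literature.IsHCobordant 4 M N`: a compact smooth 5-manifold `W` with `∂W = M ⊔ N`, both inclusions
homotopy equivalences), then there is `k : ℕ` such that `M # k (S² × S²) ≅ N # k (S² × S²)`: in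
relational form, some closed smooth 4-manifold `P` is a `k`-fold stabilisation
(`Literature.SPC4.IsStabilization k`) of both `M` and `N`. On orientations (Wall's setting is oriented) see
the module docstring: the unoriented hypothesis and relational conclusion are equivalent to the
printed statement for simply connected `M`, `N`. Nothing is asserted; users take
`(h : exists_isStabilization_of_isHCobordant)`. [cite: Wall1964, Thm. 3] -/
def exists_isStabilization_of_isHCobordant : Prop :=
  ∀ (M N : Type) [TopologicalSpace M] [T2Space M] [SecondCountableTopology M]
    [ChartedSpace (𝔼 4) M] [CompactSpace M] [IsManifold (𝓡 4) ∞ M] [SimplyConnectedSpace M]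
    [TopologicalSpace N] [T2Space N] [SecondCountableTopology N]
    [ChartedSpace (𝔼 4) N] [CompactSpace N] [IsManifold (𝓡 4) ∞ N] [SimplyConnectedSpace N]
    (_h : IsHCobordant 4 M N),
    ∃ (k : ℕ) (P : Type) (_ : TopologicalSpace P) (_ : T2Space P)
      (_ : SecondCountableTopology P) (_ : ChartedSpace (𝔼 4) P) (_ : CompactSpace P)
      (_ : IsManifold (𝓡 4) ∞ P), IsStabilization k M P ∧ IsStabilization k N P

/-! ### Corollary: every homotopy 4-sphere is stably standard -/

/-- **Every homotopy 4-sphere is stably diffeomorphic to `S⁴`** (Wall 1964, Thm 3, with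
Kervaire–Milnor 1963, Thm 1.1: `Θ₄ = 0` in the h-cobordism sense; cite item wi-03819, route
SmoothPoincare4/Stabilisation). GIVEN Wall's stabilisation theorem
(`exists_isStabilization_of_isHCobordant`), the fact that every homotopy 4-sphere is h-cobordant
to `S⁴` (`isHCobordant_sphere_of_homotopySphere_four`, `ThetaFour.lean`) and simple connectivity
of `S⁴` (`hS4`, definitionally the named fact `simplyConnectedSpace_sphere_four` of
`HomotopyS4SimplyConnected.lean`), every homotopy 4-sphere `Σ` has, for some `k`, a closed smooth
`P` which is a `k`-fold stabilisation of both `Σ` and `S⁴`: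
`Σ # k (S² × S²) ≅ S⁴ # k (S² × S²) = # k (S² × S²)`. Simple connectivity of `Σ` is transported
along `Σ ≃ₕ S⁴` (Mathlib `ContinuousMap.HomotopyEquiv.simplyConnectedSpace`). [cite: Wall1964, Thm. 3] -/
theorem exists_isStabilization_sphere_of_homotopySphere_four
    (hW : exists_isStabilization_of_isHCobordant)
    (hΘ : isHCobordant_sphere_of_homotopySphere_four)
    (hS4 : SimplyConnectedSpace (𝕊 4)) (S : HomotopySphere 4) :
    ∃ (k : ℕ) (P : Type) (_ : TopologicalSpace P) (_ : T2Space P)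
      (_ : SecondCountableTopology P) (_ : ChartedSpace (𝔼 4) P) (_ : CompactSpace P)
      (_ : IsManifold (𝓡 4) ∞ P), IsStabilization k S.carrier P ∧ IsStabilization k (𝕊 4) P := by
  obtain ⟨e⟩ := S.nonempty_homotopyEquiv
  haveI : SimplyConnectedSpace S.carrier := e.simplyConnectedSpace (hY := hS4)
  exact hW S.carrier (𝕊 4) (hΘ S)

/-- Any two homotopy 4-spheres are stably diffeomorphic (Wall 1964, Thm 3 + `Θ₄ = 0`), GIVEN in
addition transitivity of h-cobordism (the tree's named fact `Literature.Topology.FourManifolds.IsHCobordant.trans`, used through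
`Literature.Topology.FourManifolds.HomotopySphere.isHCobordant_of_theta_four`). [cite: Wall1964, Thm. 3] -/
theorem HomotopySphere.exists_isStabilization (hW : exists_isStabilization_of_isHCobordant)
    (hΘ : isHCobordant_sphere_of_homotopySphere_four) (hS4 : SimplyConnectedSpace (𝕊 4))
    (S T : HomotopySphere 4)
    (htrans : IsHCobordant.trans (n := 4) (M := S.carrier) (N := 𝕊 4) (P := T.carrier)) :
    ∃ (k : ℕ) (P : Type) (_ : TopologicalSpace P) (_ : T2Space P)
      (_ : SecondCountableTopology P) (_ : ChartedSpace (𝔼 4) P) (_ : CompactSpace P)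
      (_ : IsManifold (𝓡 4) ∞ P), IsStabilization k S.carrier P ∧ IsStabilization k T.carrier P := by
  obtain ⟨e⟩ := S.nonempty_homotopyEquiv
  obtain ⟨f⟩ := T.nonempty_homotopyEquiv
  haveI : SimplyConnectedSpace S.carrier := e.simplyConnectedSpace (hY := hS4)
  haveI : SimplyConnectedSpace T.carrier := f.simplyConnectedSpace (hY := hS4)
  exact hW S.carrier T.carrier (HomotopySphere.isHCobordant_of_theta_four hΘ S T htrans)

/-- The smooth 4-dimensional Poincaré conjecture in Wall's language: GIVEN Wall's Thm 3 and
`Θ₄ = 0`, a homotopy 4-sphere `Σ` is diffeomorphic to `S⁴` as soon as the stabilisation number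
`k` of `exists_isStabilization_sphere_of_homotopySphere_four` can be taken to be `0` for `Σ`
(trivial unfolding, recorded to pin down the interface of route SmoothPoincare4/Stabilisation:
the open content is the cancellation `k ↦ 0`). [folklore] -/
theorem HomotopySphere.nonempty_diffeomorph_sphere_of_isStabilization_zero (S : HomotopySphere 4)
    (h : ∃ (P : Type) (_ : TopologicalSpace P) (_ : ChartedSpace (𝔼 4) P),
      IsStabilization 0 S.carrier P ∧ IsStabilization 0 (𝕊 4) P) :
    Nonempty (S.carrier ≃ₘ⟮𝓡 4, 𝓡 4⟯ (𝕊 4)) := by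
  obtain ⟨P, _, _, hS, h4⟩ := h
  exact nonempty_diffeomorph_of_isStabilization_zero hS h4

end Literature.Topology.FourManifolds

end
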